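import Literature.Topology.FourManifolds.SeifertAlgebraicModelsWeierstrass
import Mathlib
import HarnessLib

/-!
# Gaussian orthogonality of harmonic homogeneous polynomials of different degrees

For real harmonic homogeneous polynomials `P`, `Q` on `ℝⁿ` of DIFFERENT degrees `k ≠ l` and every `a > 0`,

  `∫_{ℝⁿ} P(x) Q(x) e^{−a‖x‖²} dx = 0`                                        (`integral_harmonic_mul_exp_eq_zero`).

This is the Gaussian form of the orthogonality of spherical harmonics of different degrees
[cite: AxlerBourdonRamey2001, Prop. 5.9] (there on the sphere; the Gaussian weight is equivalent by polar coordinates and is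
the form used for channel projections of radially weighted expansions `Σ_j β_j(‖x‖) B_j(x)` and for Hecke's identity
[cite: SteinWeiss1971, Ch. IV Thm. 3.4]).  PROOF (Green's identity in Gaussian form, no sphere integration): integrating by parts
on the whole space (`integral_mul_fderiv_eq_neg_fderiv_mul_of_integrable`) in each coordinate direction,
`Σᵢ ∫ ∂ᵢP ∂ᵢQ e^{−a‖x‖²} = −∫ P (ΔQ − 2a x·∇Q) e^{−a‖x‖²} = 2a·l ∫ P Q e^{−a‖x‖²}` by `ΔQ = 0` and Euler's identity
`x·∇Q = l Q` (`MvPolynomial.IsHomogeneous.sum_X_mul_pderiv`); by symmetry the same sum equals `2a·k ∫ P Q e^{−a‖x‖²}`, so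
`(k − l) ∫ P Q e^{−a‖x‖²} = 0`.

Also recorded: `sum_integral_pderiv_mul_pderiv_mul_exp` — the Green/Euler identity above for one harmonic homogeneous factor and an
arbitrary polynomial cofactor.  Private infrastructure: every polynomial function times a Gaussian is integrable on `ℝⁿ` (induction on the
polynomial: `x ↦ xᵢ e^{−a‖x‖²/2}` is bounded), and the directional derivatives of the Gaussian.  The calculus of polynomial functions on
`EuclideanSpace ℝ (Fin n)` (`contDiff`, `fderiv = pderiv`) is the tree's `Literature.Topology.FourManifolds.*_mvPolynomial_eval_ofLp`.
Mathlib only has the algebra of `MvPolynomial.pderiv`; harmonic polynomials / spherical harmonics are not in Mathlib.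
-/

set_option autoImplicit false

noncomputable section

namespace Literature.Analysis.Potential

open MvPolynomial _root_.MeasureTheory
open scoped BigOperators
open Literature.Topology.FourManifolds (contDiff_mvPolynomial_eval_ofLp hasFDerivAt_mvPolynomial_eval_ofLp
  fderiv_mvPolynomial_eval_ofLp_single)

variable {n : ℕ}

/-! ## § 1. Polynomial functions times Gaussians are integrable -/

/-- The Gaussian `e^{−a‖x‖²}` is integrable on `ℝⁿ` (`a > 0`). [folklore] -/
private theorem integrable_exp_neg_mul_sq_norm {a : ℝ} (ha : 0 < a) :
    Integrable (fun x : EuclideanSpace ℝ (Fin n) => Real.exp (-(a * ‖x‖ ^ 2))) := by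
  refine Integrable.of_integral_ne_zero (fun h => ?_)
  have h1 := GaussianFourier.integral_rexp_neg_mul_sq_norm (V := EuclideanSpace ℝ (Fin n)) ha
  have h2 : (fun v : EuclideanSpace ℝ (Fin n) => Real.exp (-a * ‖v‖ ^ 2)) = fun v => Real.exp (-(a * ‖v‖ ^ 2)) := by
    funext v; ring_nf
  rw [h2, h] at h1
  have : (0 : ℝ) < (Real.pi / a) ^ (Module.finrank ℝ (EuclideanSpace ℝ (Fin n)) / 2 : ℝ) := by positivity
  linarith

/-- `|xᵢ| e^{−b‖x‖²} ≤ (1 + 1/b)/2` for `b > 0` (`|xᵢ| ≤ ‖x‖ ≤ (1 + ‖x‖²)/2` and `b‖x‖² e^{−b‖x‖²} ≤ 1`). [folklore] -/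
private theorem abs_coord_mul_exp_le {b : ℝ} (hb : 0 < b) (x : EuclideanSpace ℝ (Fin n)) (i : Fin n) :
    |x i| * Real.exp (-(b * ‖x‖ ^ 2)) ≤ (1 + 1 / b) / 2 := by
  have hxi : |x i| ≤ ‖x‖ := by
    have := PiLp.norm_apply_le x i
    rwa [Real.norm_eq_abs] at this
  have hexp1 : Real.exp (-(b * ‖x‖ ^ 2)) ≤ 1 := by
    rw [Real.exp_le_one_iff]; nlinarith [norm_nonneg x]
  have hexp2 : b * ‖x‖ ^ 2 * Real.exp (-(b * ‖x‖ ^ 2)) ≤ 1 := by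
    have h := Real.add_one_le_exp (b * ‖x‖ ^ 2)
    have hpos : 0 < Real.exp (b * ‖x‖ ^ 2) := Real.exp_pos _
    rw [Real.exp_neg]
    rw [mul_inv_le_iff₀ hpos]
    nlinarith [norm_nonneg x]
  have hamgm : ‖x‖ ≤ (1 + ‖x‖ ^ 2) / 2 := by nlinarith [sq_nonneg (‖x‖ - 1)]
  have he0 : 0 ≤ Real.exp (-(b * ‖x‖ ^ 2)) := (Real.exp_pos _).le
  calc |x i| * Real.exp (-(b * ‖x‖ ^ 2))
      ≤ (1 + ‖x‖ ^ 2) / 2 * Real.exp (-(b * ‖x‖ ^ 2)) :=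
        mul_le_mul_of_nonneg_right (hxi.trans hamgm) he0
    _ = (Real.exp (-(b * ‖x‖ ^ 2)) + (1 / b) * (b * ‖x‖ ^ 2 * Real.exp (-(b * ‖x‖ ^ 2)))) / 2 := by
        field_simp
    _ ≤ (1 + (1 / b) * 1) / 2 := by
        gcongr
    _ = (1 + 1 / b) / 2 := by ring

/-- **Polynomial functions times Gaussians are integrable on `ℝⁿ`.** [folklore] -/
private theorem integrable_eval_mul_exp (P : MvPolynomial (Fin n) ℝ) {a : ℝ} (ha : 0 < a) :
    Integrable (fun x : EuclideanSpace ℝ (Fin n) => eval (WithLp.ofLp x) P * Real.exp (-(a * ‖x‖ ^ 2))) := by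
  induction P using MvPolynomial.induction_on generalizing a with
  | C c =>
    simpa using (integrable_exp_neg_mul_sq_norm ha).const_mul c
  | add p q hp hq =>
    have h := (hp ha).add (hq ha)
    refine h.congr (Filter.Eventually.of_forall fun x => ?_)
    simp only [Pi.add_apply, map_add, add_mul]
  | mul_X p i hp =>
    have ha2 : 0 < a / 2 := by positivity
    -- `eval (p·Xᵢ) e^{−a‖x‖²} = (eval p · e^{−a‖x‖²/2}) · (xᵢ e^{−a‖x‖²/2})`, integrable × bounded
    have hmeas : AEStronglyMeasurable (fun x : EuclideanSpace ℝ (Fin n) => x i * Real.exp (-(a / 2 * ‖x‖ ^ 2))) volume := by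
      have : Continuous fun x : EuclideanSpace ℝ (Fin n) => x i * Real.exp (-(a / 2 * ‖x‖ ^ 2)) := by fun_prop
      exact this.aestronglyMeasurable
    have h := (hp ha2).mul_bdd hmeas (c := (1 + 1 / (a / 2)) / 2)
      (Filter.Eventually.of_forall fun x => by
        rw [Real.norm_eq_abs, abs_mul, abs_of_pos (Real.exp_pos _)]
        exact abs_coord_mul_exp_le ha2 x i)
    refine h.congr (Filter.Eventually.of_forall fun x => ?_)
    simp only [map_mul, eval_X]
    have : Real.exp (-(a * ‖x‖ ^ 2)) = Real.exp (-(a / 2 * ‖x‖ ^ 2)) * Real.exp (-(a / 2 * ‖x‖ ^ 2)) := by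
      rw [← Real.exp_add]; ring_nf
    rw [this]; ring

/-! ## § 2. The Gaussian weight and its directional derivatives -/

/-- `∂ᵢ e^{−a‖x‖²} = −2a xᵢ e^{−a‖x‖²}`. [folklore] -/
private theorem hasFDerivAt_exp_neg_mul_sq_norm (a : ℝ) (x : EuclideanSpace ℝ (Fin n)) :
    HasFDerivAt (fun y : EuclideanSpace ℝ (Fin n) => Real.exp (-(a * ‖y‖ ^ 2)))
      (Real.exp (-(a * ‖x‖ ^ 2)) • ((-a) • (2 • innerSL ℝ x))) x := by
  have h1 : HasFDerivAt (fun y : EuclideanSpace ℝ (Fin n) => -(a * ‖y‖ ^ 2)) ((-a) • (2 • innerSL ℝ x)) x := by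
    have h := (hasStrictFDerivAt_norm_sq x).hasFDerivAt.const_mul (-a)
    refine h.congr_fderiv ?_ |>.congr_of_eventuallyEq ?_
    · rfl
    · exact Filter.Eventually.of_forall fun y => by simp [neg_mul]
  exact h1.exp

/-- The directional derivative of the Gaussian along `eᵢ`: `−2a xᵢ e^{−a‖x‖²}`. [folklore] -/
private theorem fderiv_exp_neg_mul_sq_norm_single (a : ℝ) (x : EuclideanSpace ℝ (Fin n)) (i : Fin n) :
    fderiv ℝ (fun y : EuclideanSpace ℝ (Fin n) => Real.exp (-(a * ‖y‖ ^ 2))) x (EuclideanSpace.single i 1)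
      = -(2 * a * x i) * Real.exp (-(a * ‖x‖ ^ 2)) := by
  rw [(hasFDerivAt_exp_neg_mul_sq_norm a x).fderiv]
  simp only [_root_.smul_apply, innerSL_apply_apply, EuclideanSpace.inner_single_right, smul_eq_mul]
  simp
  ring

/-! ## § 3. Green–Euler identity and orthogonality -/

/-- **Green–Euler identity (Gaussian form).**  For a harmonic homogeneous polynomial `Q` of degree `l` and ANY polynomial `P` on
`ℝⁿ`, and `a > 0`:  `Σᵢ ∫ ∂ᵢP · ∂ᵢQ · e^{−a‖x‖²} = 2a·l · ∫ P · Q · e^{−a‖x‖²}`  (integration by parts in each coordinate, `ΔQ = 0`,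
Euler's identity `x·∇Q = lQ`). [cite: AxlerBourdonRamey2001, Prop. 5.9] -/
theorem sum_integral_pderiv_mul_pderiv_mul_exp (P Q : MvPolynomial (Fin n) ℝ) {l : ℕ} (hQ : Q.IsHomogeneous l)
    (hQh : ∑ i, pderiv i (pderiv i Q) = 0) {a : ℝ} (ha : 0 < a) :
    ∑ i : Fin n, ∫ x : EuclideanSpace ℝ (Fin n),
        eval (WithLp.ofLp x) (pderiv i P) * eval (WithLp.ofLp x) (pderiv i Q) * Real.exp (-(a * ‖x‖ ^ 2))
      = 2 * a * l * ∫ x : EuclideanSpace ℝ (Fin n),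
          eval (WithLp.ofLp x) P * eval (WithLp.ofLp x) Q * Real.exp (-(a * ‖x‖ ^ 2)) := by
  classical
  -- abbreviations
  set w : EuclideanSpace ℝ (Fin n) → ℝ := fun x => Real.exp (-(a * ‖x‖ ^ 2)) with hw
  have hw_diff : ∀ x, DifferentiableAt ℝ w x := fun x => (hasFDerivAt_exp_neg_mul_sq_norm a x).differentiableAt
  have hP_diff : ∀ (R : MvPolynomial (Fin n) ℝ) (x : EuclideanSpace ℝ (Fin n)),
      DifferentiableAt ℝ (fun y : EuclideanSpace ℝ (Fin n) => eval (WithLp.ofLp y) R) x :=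
    fun R x => (hasFDerivAt_mvPolynomial_eval_ofLp R x).differentiableAt
  -- for each `i`: the IBP step `∫ ∂ᵢP (∂ᵢQ w) = −∫ P ∂ᵢ(∂ᵢQ w) = −∫ P (∂ᵢ²Q − 2a xᵢ ∂ᵢQ) w`
  have hstep : ∀ i : Fin n,
      ∫ x : EuclideanSpace ℝ (Fin n), eval (WithLp.ofLp x) (pderiv i P) * eval (WithLp.ofLp x) (pderiv i Q) * w x
        = -∫ x : EuclideanSpace ℝ (Fin n), eval (WithLp.ofLp x) P *
            (eval (WithLp.ofLp x) (pderiv i (pderiv i Q)) * w x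
              + eval (WithLp.ofLp x) (pderiv i Q) * (-(2 * a * x i) * w x)) := by
    intro i
    -- `g := ∂ᵢQ · w` and its directional derivative
    set g : EuclideanSpace ℝ (Fin n) → ℝ := fun x => eval (WithLp.ofLp x) (pderiv i Q) * w x with hg
    have hg_deriv : ∀ x, fderiv ℝ g x (EuclideanSpace.single i 1)
        = eval (WithLp.ofLp x) (pderiv i (pderiv i Q)) * w x + eval (WithLp.ofLp x) (pderiv i Q) * (-(2 * a * x i) * w x) := by
      intro x
      rw [hg, fderiv_fun_mul (hP_diff _ x) (hw_diff x), _root_.add_apply, _root_.smul_apply,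
        _root_.smul_apply, fderiv_mvPolynomial_eval_ofLp_single, hw, fderiv_exp_neg_mul_sq_norm_single]
      simp only [smul_eq_mul]
      ring
    have hf_deriv : ∀ x, fderiv ℝ (fun y : EuclideanSpace ℝ (Fin n) => eval (WithLp.ofLp y) P) x (EuclideanSpace.single i 1)
        = eval (WithLp.ofLp x) (pderiv i P) := fun x => fderiv_mvPolynomial_eval_ofLp_single P x i
    -- integrability of the three products (polynomial × Gaussian)
    have hI1 : Integrable (fun x : EuclideanSpace ℝ (Fin n) =>
        fderiv ℝ (fun y : EuclideanSpace ℝ (Fin n) => eval (WithLp.ofLp y) P) x (EuclideanSpace.single i 1) * g x) := by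
      refine (integrable_eval_mul_exp (pderiv i P * pderiv i Q) ha).congr (Filter.Eventually.of_forall fun x => ?_)
      simp only [hf_deriv, hg, hw, map_mul]; ring
    have hI2 : Integrable (fun x : EuclideanSpace ℝ (Fin n) =>
        eval (WithLp.ofLp x) P * fderiv ℝ g x (EuclideanSpace.single i 1)) := by
      refine (integrable_eval_mul_exp (P * pderiv i (pderiv i Q) - C (2 * a) * X i * P * pderiv i Q) ha).congr
        (Filter.Eventually.of_forall fun x => ?_)
      simp only [hg_deriv, hw, map_mul, map_sub, eval_C, eval_X]
      ring
    have hI3 : Integrable (fun x : EuclideanSpace ℝ (Fin n) => eval (WithLp.ofLp x) P * g x) := by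
      refine (integrable_eval_mul_exp (P * pderiv i Q) ha).congr (Filter.Eventually.of_forall fun x => ?_)
      simp only [hg, hw, map_mul]; ring
    have hIBP := integral_mul_fderiv_eq_neg_fderiv_mul_of_integrable (μ := (volume : Measure (EuclideanSpace ℝ (Fin n))))
      (f := fun y : EuclideanSpace ℝ (Fin n) => eval (WithLp.ofLp y) P) (g := g) (v := EuclideanSpace.single i 1)
      hI1 hI2 hI3 (fun x _ => hP_diff P x) (fun x _ => (hP_diff _ x).mul (hw_diff x))
    -- rewrite both sides
    have hL : ∫ x : EuclideanSpace ℝ (Fin n), eval (WithLp.ofLp x) (pderiv i P) * eval (WithLp.ofLp x) (pderiv i Q) * w x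
        = ∫ x : EuclideanSpace ℝ (Fin n),
            fderiv ℝ (fun y : EuclideanSpace ℝ (Fin n) => eval (WithLp.ofLp y) P) x (EuclideanSpace.single i 1) * g x := by
      refine integral_congr_ae (Filter.Eventually.of_forall fun x => ?_)
      simp only [hf_deriv, hg]; ring
    rw [hL, ← neg_neg (∫ x, fderiv ℝ _ x _ * g x), ← hIBP]
    congr 1
    refine integral_congr_ae (Filter.Eventually.of_forall fun x => ?_)
    simp only [hg_deriv]
  -- sum over `i`, use `ΔQ = 0` and Euler
  have hsum : ∑ i : Fin n, ∫ x : EuclideanSpace ℝ (Fin n),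
        eval (WithLp.ofLp x) (pderiv i P) * eval (WithLp.ofLp x) (pderiv i Q) * w x
      = -∫ x : EuclideanSpace ℝ (Fin n), ∑ i : Fin n, eval (WithLp.ofLp x) P *
            (eval (WithLp.ofLp x) (pderiv i (pderiv i Q)) * w x
              + eval (WithLp.ofLp x) (pderiv i Q) * (-(2 * a * x i) * w x)) := by
    rw [integral_finsetSum _ (fun i _ => ?_), ← Finset.sum_neg_distrib]
    · exact Finset.sum_congr rfl fun i _ => hstep i
    · refine (integrable_eval_mul_exp (P * pderiv i (pderiv i Q) - C (2 * a) * X i * P * pderiv i Q) ha).congr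
        (Filter.Eventually.of_forall fun x => ?_)
      simp only [hw, map_mul, map_sub, eval_C, eval_X]
      ring
  rw [hsum]
  -- pointwise: `Σᵢ P (∂ᵢ²Q w − 2a xᵢ ∂ᵢQ w) = P·(ΔQ)·w − 2a P (x·∇Q) w = −2a l P Q w`
  have hΔ : ∀ x : EuclideanSpace ℝ (Fin n), ∑ i, eval (WithLp.ofLp x) (pderiv i (pderiv i Q)) = 0 := by
    intro x
    have := congrArg (eval (WithLp.ofLp x)) hQh
    simpa [map_sum] using this
  have hEuler : ∀ x : EuclideanSpace ℝ (Fin n), ∑ i, x i * eval (WithLp.ofLp x) (pderiv i Q) = l * eval (WithLp.ofLp x) Q := by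
    intro x
    have := congrArg (eval (WithLp.ofLp x)) hQ.sum_X_mul_pderiv
    simpa [map_sum, map_mul, eval_X, nsmul_eq_mul] using this
  have hpt : ∀ x : EuclideanSpace ℝ (Fin n), ∑ i : Fin n, eval (WithLp.ofLp x) P *
        (eval (WithLp.ofLp x) (pderiv i (pderiv i Q)) * w x + eval (WithLp.ofLp x) (pderiv i Q) * (-(2 * a * x i) * w x))
      = -(2 * a * l) * (eval (WithLp.ofLp x) P * eval (WithLp.ofLp x) Q * w x) := by
    intro x
    have h1 : ∑ i : Fin n, eval (WithLp.ofLp x) P *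
        (eval (WithLp.ofLp x) (pderiv i (pderiv i Q)) * w x + eval (WithLp.ofLp x) (pderiv i Q) * (-(2 * a * x i) * w x))
        = eval (WithLp.ofLp x) P * w x * (∑ i, eval (WithLp.ofLp x) (pderiv i (pderiv i Q)))
          - 2 * a * (eval (WithLp.ofLp x) P * w x) * ∑ i, x i * eval (WithLp.ofLp x) (pderiv i Q) := by
      rw [Finset.mul_sum, Finset.mul_sum, ← Finset.sum_sub_distrib]
      exact Finset.sum_congr rfl fun i _ => by ring
    rw [h1, hΔ x, hEuler x]
    ring
  simp_rw [hpt]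
  rw [integral_const_mul]
  ring

/-- ★ **Harmonic homogeneous polynomials of different degrees are orthogonal for every Gaussian weight**:
`∫_{ℝⁿ} P Q e^{−a‖x‖²} dx = 0` for `P`, `Q` harmonic homogeneous of degrees `k ≠ l`, `a > 0`. [cite: AxlerBourdonRamey2001, Prop. 5.9] -/
theorem integral_harmonic_mul_exp_eq_zero (P Q : MvPolynomial (Fin n) ℝ) {k l : ℕ}
    (hP : P.IsHomogeneous k) (hQ : Q.IsHomogeneous l)
    (hPh : ∑ i, pderiv i (pderiv i P) = 0) (hQh : ∑ i, pderiv i (pderiv i Q) = 0) (hkl : k ≠ l)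
    {a : ℝ} (ha : 0 < a) :
    ∫ x : EuclideanSpace ℝ (Fin n), eval (WithLp.ofLp x) P * eval (WithLp.ofLp x) Q * Real.exp (-(a * ‖x‖ ^ 2)) = 0 := by
  have h1 := sum_integral_pderiv_mul_pderiv_mul_exp P Q hQ hQh ha
  have h2 := sum_integral_pderiv_mul_pderiv_mul_exp Q P hP hPh ha
  -- the two left-hand sides agree (commutativity of the product)
  have h12 : ∑ i : Fin n, ∫ x : EuclideanSpace ℝ (Fin n),
        eval (WithLp.ofLp x) (pderiv i P) * eval (WithLp.ofLp x) (pderiv i Q) * Real.exp (-(a * ‖x‖ ^ 2))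
      = ∑ i : Fin n, ∫ x : EuclideanSpace ℝ (Fin n),
        eval (WithLp.ofLp x) (pderiv i Q) * eval (WithLp.ofLp x) (pderiv i P) * Real.exp (-(a * ‖x‖ ^ 2)) := by
    refine Finset.sum_congr rfl fun i _ => integral_congr_ae (Filter.Eventually.of_forall fun x => ?_)
    ring
  have hI : ∫ x : EuclideanSpace ℝ (Fin n), eval (WithLp.ofLp x) Q * eval (WithLp.ofLp x) P * Real.exp (-(a * ‖x‖ ^ 2))
      = ∫ x : EuclideanSpace ℝ (Fin n), eval (WithLp.ofLp x) P * eval (WithLp.ofLp x) Q * Real.exp (-(a * ‖x‖ ^ 2)) := by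
    refine integral_congr_ae (Filter.Eventually.of_forall fun x => ?_)
    ring
  rw [h12, h2, hI] at h1
  -- `2a k I = 2a l I` with `k ≠ l`, `a ≠ 0`
  have hkl' : (k : ℝ) ≠ l := by exact_mod_cast hkl
  have : (2 * a * k - 2 * a * l) * ∫ x : EuclideanSpace ℝ (Fin n),
      eval (WithLp.ofLp x) P * eval (WithLp.ofLp x) Q * Real.exp (-(a * ‖x‖ ^ 2)) = 0 := by
    rw [sub_mul, h1, sub_self]
  rcases mul_eq_zero.mp this with h | h
  · exfalso; apply hkl'
    have : 2 * a * ((k : ℝ) - l) = 0 := by linarith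
    rcases mul_eq_zero.mp this with h' | h'
    · linarith
    · linarith
  · exact h

end Literature.Analysis.Potential

end
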